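import Summits.QuantumFields.YangMills.Theorems.UnitScaleTiltProp7FaceFluxLineMean
import HarnessLib

/-!
# Route `UnitScaleTilt`, crux K1 «MinimiserStabilityRegPr» (stmt-QuantumFields-19200), line «route-R», stub P `stub_relPoincareOpt` — P-lin-flat step N5 (CARD-19200-V3-g11 §2),
# THIRD PART: THE TWO FACE DESCRIPTIONS AGREE ON EVERY `Setup` TORUS, AND THE INSTANCES AT THE d = 3 CARRIER OF THE T³ FAMILY

Cell `ym3-torus`, width seat `ym-ust-20520-w2` (g2).  THEOREMS ONLY (0 `def`, 0 `sorry`); `--supports stmt-QuantumFields-19200`, count-neutral.  Continues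
`…Prop7FaceFlux` (§1–§4) and `…Prop7FaceFluxLineMean` (§5–§6).  YM₃ on T³ is a ladder rung (R3), not the Clay problem; nothing here claims P, the stub, the crux or the gap.

* §7 a `Setup.Params` torus has `2·L^{m+K−j} ≥ 2` sites per direction at every level, so the hypothesis `1 < sitesPerDir i'` of §5 is free:
  `faceFilter_eq_layer'` (block-map face = last layer, unconditionally), `proj_shift_eq_shift_iff'`, `card_faceFilter`.
* §8 the instances at the carrier of the T³ family (`P := F.P K`, fine level `0`, coarse level `e = K − n`, `h := Prop7FlatCoercivity.sitesPerDir_T3 F n K`, `d = 3`), in the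
  shape of ★p1's `Prop7FlatCoercivity.sum_sq_le_lineBlockAvg_add_grad_T3`: `sum_faceLayer_mul_coarseGrad_eq_zero_T3` (N5 (ii)), `faceLayer_coclosed_T3` (N5 (i)),
  `card_faceLayer_T3` (`(L^{K−n})²` bonds per face), ★★ `sum_sq_lineMean_sub_faceMean_le_T3` (N5 (iii): factor `(L^{K−n})⁻¹` in front of `Σ_μ Σ_x (B(x+e_μ,μ) − B(x,μ))²`).

References: T. Bałaban, CMP 95 (1984) 17–40 [Balaban1984PropagatorsI] ((1.18)–(1.21) pp.20–21); CMP 99 (1985) 75–102 [Balaban1985UV3] ((1)–(3) p.256).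
-/

noncomputable section

open scoped BigOperators

namespace Summit.QuantumFields.YangMills.Theorems.Prop7FaceFluxT3

open Literature.MathematicalPhysics.QuantumFieldTheory.Balaban1983to89
open Finset LatticeFieldCalculus
open Summit.QuantumFields.YangMills.Theorems.Prop7FaceFlux
open Summit.QuantumFields.YangMills.Theorems.Prop7FaceFluxLineMean
open Summit.QuantumFields.YangMills.Theorems.Prop7FlatCoercivity (sitesPerDir_T3)

/-! ## §7 Every `Setup` torus has at least two sites per direction -/

section Generic

variable {P : Params} {i i' e : ℕ}

/-- ★ The face test in residue form, unconditionally (`|T^{(i′)}| = 2·L^{m+K−i′} ≥ 2` per direction — the kernel fact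
`BIJ85Ineq732FlatRegion.two_le_sitesPerDir`, re-derived inline to keep the import leaf light): `proj (x + e_μ) = proj x + e_μ ↔ L^e ∣ x_μ + 1`. [folklore] -/
theorem proj_shift_eq_shift_iff' (h : P.sitesPerDir i = P.L ^ e * P.sitesPerDir i') (x : Site P i) (μ : Fin P.d) :
    Site.proj i' e (x.shift μ) = (Site.proj i' e x).shift μ ↔ P.L ^ e ∣ (x μ).val + 1 := by
  have hN' : 1 < P.sitesPerDir i' := by
    unfold Params.sitesPerDir
    have := Nat.one_le_pow (P.m + P.K - i') _ P.L_pos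
    omega
  exact proj_shift_eq_shift_iff h hN' x μ

/-- ★ The block-map face of `…Prop7FaceFlux` §3–§4 IS the last layer of `…Prop7FaceFluxLineMean` §5, on every `Setup` torus. [folklore] -/
theorem faceFilter_eq_layer' (h : P.sitesPerDir i = P.L ^ e * P.sitesPerDir i') (μ : Fin P.d) (y : Site P i') :
    univ.filter (fun x : Site P i => Site.proj i' e x = y ∧ Site.proj i' e (x.shift μ) = y.shift μ)
      = univ.filter (fun x : Site P i => Site.proj i' e x = y ∧ (x μ).val % P.L ^ e + 1 = P.L ^ e) := by
  have hN' : 1 < P.sitesPerDir i' := by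
    unfold Params.sitesPerDir
    have := Nat.one_le_pow (P.m + P.K - i') _ P.L_pos
    omega
  exact faceFilter_eq_layer h hN' μ y

/-- The block-map face has `(L^e)^{d−1}` sites. [folklore] -/
theorem card_faceFilter (h : P.sitesPerDir i = P.L ^ e * P.sitesPerDir i') (y : Site P i') (μ : Fin P.d) :
    (univ.filter (fun x : Site P i => Site.proj i' e x = y ∧ Site.proj i' e (x.shift μ) = y.shift μ)).card = (P.L ^ e) ^ (P.d - 1) := by
  rw [faceFilter_eq_layer' h μ y, card_faceLayer h y μ]

end Generic

/-! ## §8 At the carrier of the T³ family (run `K` over the comparison height `n`) -/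

section T3

variable (F : T3ContinuumYM3Torus.T3Family) (n K : ℕ)

/-- ★ **N5 (ii) AT THE T³ CARRIER**: for a divergence-free real bond field `B` on the finest torus of run `K` and every function `g` on the comparison lattice
`T^{(K−n)}`, `Σ_c (g(c₊) − g(c₋)) · Σ_{face of c} B = 0`. [cite: Balaban1984PropagatorsI, (1.21) p.21] -/
theorem sum_faceLayer_mul_coarseGrad_eq_zero_T3 {c₀ : ℝ} (hc₀ : c₀ ≠ 0) {B : PBond (F.P K) 0 → ℝ} (hB : diverg c₀ B = 0)
    (g : Site (F.P K) (K - n) → ℝ) :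
    ∑ c : PBond (F.P K) (K - n), (g c.tgt - g c.src) *
        ∑ x ∈ univ.filter (fun x : Site (F.P K) 0 =>
          Site.proj (K - n) (K - n) x = c.src ∧ (x c.dir).val % (F.P K).L ^ (K - n) + 1 = (F.P K).L ^ (K - n)), B ⟨x, c.dir⟩ = 0 :=
  sum_faceLayer_mul_coarseGrad_eq_zero (sitesPerDir_T3 F n K) hc₀ hB g

/-- ★ **N5 (i) AT THE T³ CARRIER**: the face flux of a divergence-free `B` is co-closed on the comparison lattice. [cite: Balaban1984PropagatorsI, (1.21) p.21] -/
theorem faceLayer_coclosed_T3 {c₀ : ℝ} (hc₀ : c₀ ≠ 0) {B : PBond (F.P K) 0 → ℝ} (hB : diverg c₀ B = 0) (c' : ℝ) (y : Site (F.P K) (K - n)) :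
    diverg c' (fun c : PBond (F.P K) (K - n) =>
      ∑ x ∈ univ.filter (fun x : Site (F.P K) 0 =>
        Site.proj (K - n) (K - n) x = c.src ∧ (x c.dir).val % (F.P K).L ^ (K - n) + 1 = (F.P K).L ^ (K - n)), B ⟨x, c.dir⟩) y = 0 :=
  faceLayer_coclosed (sitesPerDir_T3 F n K) hc₀ hB c' y

/-- Each face of the comparison lattice is crossed by `(L^{K−n})²` fine bonds. [folklore] -/
theorem card_faceLayer_T3 (y : Site (F.P K) (K - n)) (μ : Fin (F.P K).d) :
    (univ.filter (fun x : Site (F.P K) 0 =>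
      Site.proj (K - n) (K - n) x = y ∧ (x μ).val % (F.P K).L ^ (K - n) + 1 = (F.P K).L ^ (K - n))).card = (F.L ^ (K - n)) ^ 2 :=
  card_faceLayer (sitesPerDir_T3 F n K) y μ

/-- ★★ **N5 (iii) AT THE T³ CARRIER** (`ℓ = L^{K−n}`, `d = 3`): for every real bond field `B` on the finest torus of run `K`,
`Σ_c ((M_{K−n}B)(c) − ℓ^{−2}·Σ_{face of c} B)² ≤ ℓ^{−1} · Σ_μ Σ_x (B(x + e_μ, μ) − B(x, μ))²`, the first term being ★p1's straight-line block mean of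
`Prop7FlatCoercivity.sum_sq_le_lineBlockAvg_add_grad_T3`, uniformly in the volume exponent `m`, in `n` and in `K`. [folklore] -/
theorem sum_sq_lineMean_sub_faceMean_le_T3 (B : PBond (F.P K) 0 → ℝ) :
    ∑ c : PBond (F.P K) (K - n),
        (((((F.P K).L : ℝ) ^ (K - n)) ^ (F.P K).d * ((F.P K).L : ℝ) ^ (K - n))⁻¹
            * ∑ x ∈ univ.filter (fun x : Site (F.P K) 0 => Site.proj (K - n) (K - n) x = c.src), ∑ t ∈ range ((F.P K).L ^ (K - n)),
                B ⟨(fun z : Site (F.P K) 0 => z.shift c.dir)^[t] x, c.dir⟩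
          - ((F.P K).L : ℝ) ^ (K - n) * ((((F.P K).L : ℝ) ^ (K - n)) ^ (F.P K).d)⁻¹
            * ∑ x ∈ univ.filter (fun x : Site (F.P K) 0 =>
                Site.proj (K - n) (K - n) x = c.src ∧ (x c.dir).val % (F.P K).L ^ (K - n) + 1 = (F.P K).L ^ (K - n)), B ⟨x, c.dir⟩) ^ 2
      ≤ ((F.L : ℝ) ^ (K - n))⁻¹ * ∑ μ : Fin (F.P K).d, ∑ x : Site (F.P K) 0, (B ⟨x.shift μ, μ⟩ - B ⟨x, μ⟩) ^ 2 := by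
  have hmain := sum_sq_lineMean_sub_faceMean_le (sitesPerDir_T3 F n K) B
  have hL : (0 : ℝ) < (F.L : ℝ) ^ (K - n) := pow_pos (by exact_mod_cast (F.P K).L_pos) _
  have hcoef : (((F.P K).L : ℝ) ^ (K - n)) ^ 2 * ((((F.P K).L : ℝ) ^ (K - n)) ^ (F.P K).d)⁻¹ = ((F.L : ℝ) ^ (K - n))⁻¹ := by
    show ((F.L : ℝ) ^ (K - n)) ^ 2 * (((F.L : ℝ) ^ (K - n)) ^ 3)⁻¹ = ((F.L : ℝ) ^ (K - n))⁻¹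
    field_simp
  rw [hcoef] at hmain
  exact hmain

end T3

end Summit.QuantumFields.YangMills.Theorems.Prop7FaceFluxT3

end
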